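import Summits.Ventures.CertifiedArithmetic.LowPrec.ErrorTables

/-!
# Structural error envelopes valid for every format (FP8 and beyond without enumeration)

HONEST FRAMING (venture CertifiedArithmetic / cell `pub-lowprec`): certified error envelopes and
provably optimal rounding/accumulation schemes for low-precision formats under stated cost models;
every table by two implementations; no hardware or vendor claims.

Two envelopes proved for `roundNE` on ANY `Format`, indexed the way the exhaustive tables are:
* ABSOLUTE, per exponent code `E` of the ROUNDED result: for `|x| ≤ maxRat`,
  `|x - fl x| ≤ ½ · 2^(E-1) · quantum` (half the spacing of the result's binade; `E = 0`, the
  subnormal binade, has spacing one quantum) — `abs_sub_roundNE_le_half_ulp_result`;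
* RELATIVE, sharp: for `2^m · quantum ≤ |x| ≤ maxRat` (normal range),
  `|x - fl x| ≤ u/(1+u) · |x|` — the optimal relative error constant of round-to-nearest
  (Dekker 1971 / Knuth; [JeannerodRump2018, Thm 2.1]) — `abs_sub_roundNE_le_sharp`.
Consequently every in-range row of every product/sum table of every format sits inside these
envelopes (`errMul`/`errAdd` corollaries), which is the FP8 (`E4M3`, `E5M2`) per-binade envelope
"from structure"; attainment in each binade of `E4M3`/`E5M2` is certified by explicit witness
pairs (kernel evaluation of single rows, no enumeration).
-/

namespace Literature.ComputerArithmetic.FloatingPoint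

namespace MiniFloat

open Format

variable {φ : Format}

/-- Exponent code of the rounded datum, by definition of `roundNE`. [folklore] -/
theorem expCode_roundNE (x : ℚ) :
    (roundNE φ x).expCode = φ.expOf (φ.rneGrid (|x| / φ.quantum)) := rfl

/-- In range, the rounded magnitude is at least the floor binade of the input:
`2^(m+s) ≤ r ≤ maxScaled` implies `2^(m+s) ≤ rneGrid r`. [folklore] -/
theorem pow_le_rneGrid {r : ℚ} (hr : 0 ≤ r) (hle : r ≤ φ.maxScaled)
    (hfloor : (2 : ℚ) ^ (φ.manBits + φ.shift ⌊r⌋.toNat) ≤ r) :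
    2 ^ (φ.manBits + φ.shift ⌊r⌋.toNat) ≤ φ.rneGrid r := by
  set s := φ.shift ⌊r⌋.toNat with hs
  -- the floor g = 2^(m+s) = (2^m + 0) 2^s is representable and ≤ r
  have hsle : s ≤ φ.emaxCode - 1 := shift_le _
  have hgrep : φ.Representable ((2 ^ φ.manBits + 0) * 2 ^ s) := by
    refine representable_mul_pow (by have := Nat.two_pow_pos φ.manBits; rw [pow_succ]; omega) ?_
    -- (2^m) 2^s ≤ maxScaled since r ≤ maxScaled and 2^(m+s) ≤ r
    have : ((2 ^ (φ.manBits + s) : ℕ) : ℚ) ≤ φ.maxScaled := by push_cast; exact le_trans hfloor hle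
    have h' : 2 ^ (φ.manBits + s) ≤ φ.maxScaled := by exact_mod_cast this
    simpa [pow_add] using h'
  have h1 := Format.abs_sub_rneGrid_le hr hgrep
  have e : (((2 ^ φ.manBits + 0) * 2 ^ s : ℕ) : ℚ) = (2 : ℚ) ^ (φ.manBits + s) := by
    push_cast; ring
  rw [e, abs_of_nonneg (by linarith : (0 : ℚ) ≤ r - 2 ^ (φ.manBits + s))] at h1
  -- |r - n| ≤ r - g ⇒ n ≥ g
  have h2 : (2 : ℚ) ^ (φ.manBits + s) ≤ φ.rneGrid r := by
    have := le_abs_self (r - (φ.rneGrid r : ℚ))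
    linarith
  exact_mod_cast h2

/-- ABSOLUTE ENVELOPE BY RESULT BINADE (all formats): for `|x| ≤ maxRat`,
`|x - fl x| ≤ ½ · 2^(E-1) · quantum` where `E` is the exponent code of `fl x = roundNE φ x`
(`2^(E-1)` quanta is the spacing of binade `E ≥ 1`; for `E = 0` the bound reads `½ · quantum`).
[folklore] -/
theorem abs_sub_roundNE_le_half_ulp_result {x : ℚ} (h : |x| ≤ φ.maxRat) :
    |x - (roundNE φ x).toRat| ≤ 2 ^ ((roundNE φ x).expCode - 1) / 2 * φ.quantum := by
  have hq := φ.quantum_pos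
  have hr := scaledInput_nonneg (φ := φ) x
  have hle : |x| / φ.quantum ≤ φ.maxScaled := by rw [div_le_iff₀ hq]; exact h
  have h1 := abs_sub_roundNE_le_half_spacing h
  refine le_trans h1 (mul_le_mul_of_nonneg_right ?_ hq.le)
  apply div_le_div_of_nonneg_right _ (by norm_num)
  apply pow_le_pow_right₀ (by norm_num)
  -- s ≤ E - 1
  rcases Format.shift_floor_dichotomy (φ := φ) hr with hs | hfloor
  · rw [hs]; exact Nat.zero_le _
  · have hn := pow_le_rneGrid hr hle hfloor
    rw [expCode_roundNE]
    have hm : 2 ^ φ.manBits ≤ φ.rneGrid (|x| / φ.quantum) :=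
      le_trans (Nat.pow_le_pow_right (by norm_num) (Nat.le_add_right _ _)) hn
    unfold Format.expOf
    rw [if_neg (not_lt.mpr hm)]
    -- shift (rneGrid r) ≥ s by monotonicity from 2^(m+s) = (2^m + 0)·2^s
    have hsh : φ.shift (2 ^ (φ.manBits + φ.shift ⌊|x| / φ.quantum⌋.toNat))
        = φ.shift ⌊|x| / φ.quantum⌋.toNat := by
      have := shift_scaled_succ (φ := φ) (T := 0) (j := φ.shift ⌊|x| / φ.quantum⌋.toNat)
        (Nat.two_pow_pos _) (shift_le _)
      simpa [pow_add] using this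
    have := Format.shift_mono (φ := φ) hn
    rw [hsh] at this
    omega

/-- SHARP RELATIVE ENVELOPE (all formats): in the normal range `2^m · quantum ≤ |x| ≤ maxRat`,
`|x - fl x| ≤ u/(1+u) · |x|`, the optimal constant for round-to-nearest (attained at
`x = (1 + u)·2^e`). [folklore] -/
theorem abs_sub_roundNE_le_sharp {x : ℚ} (hlo : 2 ^ φ.manBits * φ.quantum ≤ |x|)
    (hhi : |x| ≤ φ.maxRat) :
    |x - (roundNE φ x).toRat| ≤ φ.unitRoundoff / (1 + φ.unitRoundoff) * |x| := by
  have hq := φ.quantum_pos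
  have hu := φ.unitRoundoff_pos
  have hr := scaledInput_nonneg (φ := φ) x
  set r := |x| / φ.quantum with hr_def
  have hxr : |x| = r * φ.quantum := by rw [hr_def, div_mul_cancel₀ _ (ne_of_gt hq)]
  have hle : r ≤ φ.maxScaled := by rw [hr_def, div_le_iff₀ hq]; exact hhi
  have hrm : (2 : ℚ) ^ φ.manBits ≤ r := by rw [hr_def, le_div_iff₀ hq]; exact hlo
  -- the floor g = 2^(m+s) of the input binade
  have hfloor : (2 : ℚ) ^ (φ.manBits + φ.shift ⌊r⌋.toNat) ≤ r := by
    rcases Format.shift_floor_dichotomy (φ := φ) hr with hs | hfl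
    · rw [hs, add_zero]; exact hrm
    · exact hfl
  set s := φ.shift ⌊r⌋.toNat with hs_def
  set g : ℚ := (2 : ℚ) ^ (φ.manBits + s) with hg
  -- (a) |r - n| ≤ r - g  (g representable, nearest property)
  have hgrep : φ.Representable ((2 ^ φ.manBits + 0) * 2 ^ s) := by
    refine representable_mul_pow (by have := Nat.two_pow_pos φ.manBits; rw [pow_succ]; omega) ?_
    have : ((2 ^ (φ.manBits + s) : ℕ) : ℚ) ≤ φ.maxScaled := by push_cast; exact le_trans hfloor hle
    have h' : 2 ^ (φ.manBits + s) ≤ φ.maxScaled := by exact_mod_cast this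
    simpa [pow_add] using h'
  have ha := Format.abs_sub_rneGrid_le hr hgrep
  have e : (((2 ^ φ.manBits + 0) * 2 ^ s : ℕ) : ℚ) = g := by rw [hg]; push_cast; ring
  rw [e, abs_of_nonneg (by linarith : (0 : ℚ) ≤ r - g)] at ha
  -- (b) |r - n| ≤ 2^s / 2 = u · g
  have hb := Format.abs_sub_rneGrid_le_half_spacing hr hle
  have hug : (2 : ℚ) ^ s / 2 = φ.unitRoundoff * g := by
    rw [Format.unitRoundoff_eq, hg]; field_simp; ring
  rw [← hs_def, hug] at hb
  -- combine: e ≤ r - g and e ≤ u g ⇒ e (1 + u) ≤ u r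
  have key : |r - (φ.rneGrid r : ℚ)| ≤ φ.unitRoundoff / (1 + φ.unitRoundoff) * r := by
    rw [div_mul_eq_mul_div, le_div_iff₀ (by linarith)]
    have := mul_le_mul_of_nonneg_left ha hu.le
    linarith
  rw [abs_sub_roundNE, ← hr_def, hxr, ← mul_assoc]
  exact mul_le_mul_of_nonneg_right key hq.le

/-- PRODUCT rows inside the structural envelopes (all formats): in range,
`|fl(ab) - ab| ≤ ½ · 2^(E-1) · quantum` with `E` the exponent code of `fmul`'s value-equal
`roundNE`. [folklore] -/
theorem abs_errMul_le_half_ulp_result (a b : MiniFloat φ) (h : |a.toRat * b.toRat| ≤ φ.maxRat) :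
    |errMul φ a b| ≤ 2 ^ ((roundNE φ (a.toRat * b.toRat)).expCode - 1) / 2 * φ.quantum := by
  unfold errMul; rw [abs_sub_comm]; exact abs_sub_roundNE_le_half_ulp_result h

/-- SUM rows inside the structural envelopes (all formats). [folklore] -/
theorem abs_errAdd_le_half_ulp_result (a b : MiniFloat φ) (h : |a.toRat + b.toRat| ≤ φ.maxRat) :
    |errAdd φ a b| ≤ 2 ^ ((roundNE φ (a.toRat + b.toRat)).expCode - 1) / 2 * φ.quantum := by
  unfold errAdd; rw [abs_sub_comm]; exact abs_sub_roundNE_le_half_ulp_result h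

/-- PRODUCT rows, sharp relative envelope in the normal range (all formats). [folklore] -/
theorem abs_errMul_le_sharp (a b : MiniFloat φ) (hlo : 2 ^ φ.manBits * φ.quantum ≤ |a.toRat * b.toRat|)
    (hhi : |a.toRat * b.toRat| ≤ φ.maxRat) :
    |errMul φ a b| ≤ φ.unitRoundoff / (1 + φ.unitRoundoff) * |a.toRat * b.toRat| := by
  unfold errMul; rw [abs_sub_comm]; exact abs_sub_roundNE_le_sharp hlo hhi

/-- SUM rows, sharp relative envelope in the normal range (all formats). [folklore] -/
theorem abs_errAdd_le_sharp (a b : MiniFloat φ) (hlo : 2 ^ φ.manBits * φ.quantum ≤ |a.toRat + b.toRat|)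
    (hhi : |a.toRat + b.toRat| ≤ φ.maxRat) :
    |errAdd φ a b| ≤ φ.unitRoundoff / (1 + φ.unitRoundoff) * |a.toRat + b.toRat| := by
  unfold errAdd; rw [abs_sub_comm]; exact abs_sub_roundNE_le_sharp hlo hhi

end MiniFloat

end Literature.ComputerArithmetic.FloatingPoint
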